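import Summits.BirchSwinnertonDyer.BirchSwinnertonDyer.Theorems.PrintCFramBottomClassIndexLawFiveLeHalfIntegralBridge
import HarnessLib

/-!
# The `q`-expansion of `θ(tz)` and of the products `H · θ(Q²·)^p` (NF-B with its `q`-expansion)

Width seat `bsd-line-cfram-p1-w8` g7 on crux stmt-BirchSwinnertonDyer-20372
`PrintCFram.BottomClassIndexLawFiveLe`, line `eisenstein-resource-bdp-line`, registry v23, typing sub-lane
NF-B (crux notes `Lines/eisenstein-resource-bdp-line-w8g6-notes.md` §3.2; LEAD g13 2026-08-29T02:05:23Z: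
«θ₀(Q²z)² ∈ ModularForm (Gamma1 (4Q²)) 1 with the r₂-type q-expansion»). Sequel to
`…HalfIntegralBridge` (p689819: `θ(Q²·) ∈ M_{1/2}(4Q², 1)`, the bridge `M_{2k/2}(N,χ) ⊆
ModularForm (Γ₁(N)) k`, the NF-A socket `H · θ(Q²·)^p ∈ ModularForm (Γ₁(N)) (k + (p+1)/2)`). Here the
`q`-EXPANSIONS, which is the currency in which (CutForm⁶) is stated (`G·T` with `T` the reduction of the
`q`-expansion of `θ₀(Q²z)^p`):

* §6 `hasSum_thetaMul_nat`, **`qCoeffs_thetaMul`**: `θ_t(τ) = Σ_{n ≥ 0} r_t(n) qⁿ`,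
  `r_t(n) = #{m ∈ ℤ : t m² = n}` (from the tree's `Tunnell1983.hasSum_thetaMul` over `ℤ`, summing over
  the fibres of `m ↦ t m²`); **`exists_powerSeries_nat_qExpansion_thetaMul`**: `qExpansion 1 θ_t` is the
  image of a power series `Θ ∈ ℕ⟦q⟧` with constant term `1` and support in `{t m²}` — exactly what the
  reduction `T = Θ^p mod p` needs (`T ≠ 0`; `T` supported on `pℕ` after Frobenius).
* §7 `qExpansion_pow_of_mem`, **`qExpansion_mul_thetaMul_sq_pow`**:
  `qExpansion 1 (H · θ_{Q²}^p) = qExpansion 1 H · (qExpansion 1 θ_{Q²})^p` for `H ∈ M_{k/2}(N, χ)`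
  (Mathlib `qExpansion_mul` + analyticity of cusp functions of members);
  **`exists_modularForm_thetaMul_sq_sq_qExpansion`** (NF-B with its `q`-expansion: `f ∈ ModularForm
  (Gamma1 (4Q²)) 1`, `⇑f = θ(Q²·)²`, `qExpansion 1 f = Θ²`) and
  **`exists_modularForm_mul_thetaMul_sq_pow_qExpansion`** (the NF-A socket with its `q`-expansion:
  `⇑f = H · θ(Q²·)^p`, `qExpansion 1 f = qExpansion 1 H · Θ^p`).

No new definitions, no named facts, no `sorry`. beyond-print theorem: NO. BSD is not proved by any of
this; no summit statement is proved by this seat; no registered stub is closed by this file.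

## References

* J. B. Tunnell, *A classical Diophantine problem and modular forms of weight 3/2*, Invent. Math. 72
  (1983) 323–334, p. 326. [Tunnell1983Congruent]
* G. Shimura, *On modular forms of half integral weight*, Ann. of Math. 97 (1973) 440–481, §1.
  [Shimura1973HalfIntegral]
* H. Cohen, *Sums involving the values at negative integers of L-functions of quadratic characters*,
  Math. Ann. 217 (1975) 271–285, Thm. 3.1. [Cohen1975]
-/

set_option autoImplicit false
-- summit-side namespace (single-conjunct summit, D-0017 layout)
set_option linter.dupNamespace false

noncomputable section

open scoped MatrixGroups NumberTheorySymbols ModularForm Manifold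

open UpperHalfPlane hiding I
open Complex Filter Topology CongruenceSubgroup

namespace Summit.BirchSwinnertonDyer.BirchSwinnertonDyer.Theorems.PrintCFram.HalfIntegralBridge

open Literature.NumberTheory.EllipticCurves.ModularForms
open Literature.NumberTheory.EllipticCurves.Tunnell1983

variable {N : ℕ}

/-! ## §6 The `q`-expansion of `θ(tz)`: `θ_t = Σ_n r_t(n) qⁿ`, `r_t(n) = #{m ∈ ℤ : t m² = n}` -/

/-- `|m| ≤ t m²` for `t ≥ 1`: the solutions of `t m² = n` lie in `[-n, n]`. [folklore] -/
theorem natAbs_le_of_mul_sq_eq {t : ℕ} (ht : 0 < t) {m : ℤ} {n : ℕ} (h : (t : ℤ) * m ^ 2 = n) :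
    -(n : ℤ) ≤ m ∧ m ≤ n := by
  have ht1 : (1 : ℤ) ≤ t := by exact_mod_cast ht
  have hm : |m| ≤ m ^ 2 := by
    rcases le_or_gt 0 m with h0 | h0
    · rw [abs_of_nonneg h0]; nlinarith
    · rw [abs_of_neg h0]; nlinarith
  have h2 : m ^ 2 ≤ n := by nlinarith [sq_nonneg m]
  exact abs_le.mp (hm.trans h2)

/-- **The `q`-series of `θ_t` over `ℕ`**: `θ_t(τ) = Σ_{n ≥ 0} r_t(n) e^{2πinτ}` with
`r_t(n) = #{m ∈ ℤ : t m² = n}` (written as a filtered `Finset.Icc (-n) n`, where all solutions live),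
obtained from the tree's `hasSum_thetaMul` (`Σ_{m ∈ ℤ} e^{2πi t m² τ}`) by summing over the fibres of
`m ↦ t m²`. [folklore] -/
theorem hasSum_thetaMul_nat {t : ℕ} (ht : 0 < t) (τ : ℍ) :
    HasSum (fun n : ℕ ↦ (((Finset.Icc (-(n : ℤ)) n).filter (fun m : ℤ ↦ (t : ℤ) * m ^ 2 = n)).card : ℂ) *
      Function.Periodic.qParam 1 τ ^ n) (thetaMul t τ) := by
  classical
  set E : ℤ → ℕ := fun m ↦ ((t : ℤ) * m ^ 2).toNat with hE
  have hnn : ∀ m : ℤ, 0 ≤ (t : ℤ) * m ^ 2 := fun m ↦ by positivity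
  have h0 : HasSum (fun m : ℤ ↦ Function.Periodic.qParam 1 τ ^ E m) (thetaMul t τ) := by
    refine (hasSum_thetaMul ht τ).congr_fun fun m ↦ ?_
    rw [← cexp_two_pi_I_natCast]
    have hEm : ((E m : ℕ) : ℤ) = (t : ℤ) * m ^ 2 := Int.toNat_of_nonneg (hnn m)
    have : ((E m : ℕ) : ℂ) = (((t : ℤ) * m ^ 2 : ℤ) : ℂ) := by exact_mod_cast hEm
    rw [this]
  have h := h0.tsum_fiberwise E
  refine h.congr_fun fun n ↦ ?_
  have hfib : ∀ m, m ∈ E ⁻¹' {n} ↔ (t : ℤ) * m ^ 2 = n := fun m ↦ by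
    simp only [Set.mem_preimage, Set.mem_singleton_iff, hE]
    constructor
    · intro h; rw [← h]; exact (Int.toNat_of_nonneg (hnn m)).symm
    · intro h; rw [h, Int.toNat_natCast]
  symm
  rw [tsum_subtype (E ⁻¹' {n}) (fun m ↦ Function.Periodic.qParam 1 τ ^ E m),
    tsum_eq_sum (s := Finset.Icc (-(n : ℤ)) n)]
  · rw [Finset.card_filter]
    push_cast
    rw [Finset.sum_mul]
    refine Finset.sum_congr rfl fun m _ ↦ ?_
    rw [Set.indicator_apply]
    by_cases hm : (t : ℤ) * m ^ 2 = n
    · rw [if_pos ((hfib m).mpr hm), if_pos hm, one_mul, show E m = n from by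
        rw [hE]; simp only [hm, Int.toNat_natCast]]
    · rw [if_neg (fun h' ↦ hm ((hfib m).mp h')), if_neg hm, zero_mul]
  · intro m hm
    rw [Set.indicator_of_notMem]
    intro hmem
    exact hm (Finset.mem_Icc.mpr (natAbs_le_of_mul_sq_eq ht ((hfib m).mp hmem)))

/-- **The `q`-expansion coefficients of `θ_t`**: `qCoeffs (thetaMul t) n = r_t(n) = #{m ∈ ℤ : t m² = n}`
(so `1` at `n = 0`, `2` at `n = t m²` with `m ≠ 0`, `0` otherwise). [folklore] -/
theorem qCoeffs_thetaMul {t : ℕ} (ht : 0 < t) :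
    qCoeffs (thetaMul t) = fun n : ℕ ↦
      (((Finset.Icc (-(n : ℤ)) n).filter (fun m : ℤ ↦ (t : ℤ) * m ^ 2 = n)).card : ℂ) :=
  qCoeffs_eq_of_hasSum (hasSum_thetaMul_nat ht)

/-- The only solution of `t m² = 0` in `[-0, 0]` is `m = 0`: `r_t(0) = 1`. [folklore] -/
theorem card_filter_mul_sq_eq_zero (t : ℕ) :
    ((Finset.Icc (-((0 : ℕ) : ℤ)) (0 : ℕ)).filter (fun m : ℤ ↦ (t : ℤ) * m ^ 2 = (0 : ℕ))).card = 1 := by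
  rw [Finset.card_eq_one]
  refine ⟨0, ?_⟩
  ext m
  simp only [Finset.mem_filter, Finset.mem_Icc, Finset.mem_singleton, Nat.cast_zero, neg_zero]
  constructor
  · rintro ⟨⟨h1, h2⟩, -⟩; omega
  · rintro rfl; exact ⟨⟨le_rfl, le_rfl⟩, by ring⟩

/-- `r_t(n) = 0` unless `n = t m²` for some `m ∈ ℕ`. [folklore] -/
theorem card_filter_mul_sq_eq_eq_zero {t : ℕ} {n : ℕ} (h : ∀ m : ℕ, n ≠ t * m ^ 2) :
    ((Finset.Icc (-(n : ℤ)) n).filter (fun m : ℤ ↦ (t : ℤ) * m ^ 2 = n)).card = 0 := by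
  rw [Finset.card_eq_zero, Finset.filter_eq_empty_iff]
  intro m _ hm
  apply h m.natAbs
  have : (t : ℤ) * (m.natAbs : ℤ) ^ 2 = n := by rw [Int.natCast_natAbs, sq_abs]; exact hm
  exact_mod_cast this.symm

/-- **The `q`-expansion of `θ_t` has natural-number coefficients supported on `{t m²}` with constant
term `1`** — the three facts the reduction `T = θ₀(Q²z)^p mod p` of (CutForm⁶) uses (`T ≠ 0`, and after
Frobenius `T` is supported on multiples of `p`): packaged as the existence of a power series over `ℕ`
mapping to `qExpansion 1 (thetaMul t)`. [folklore] -/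
theorem exists_powerSeries_nat_qExpansion_thetaMul {t : ℕ} (ht : 0 < t) :
    ∃ Θ : PowerSeries ℕ, qExpansion 1 (thetaMul t) = Θ.map (Nat.castRingHom ℂ) ∧
      PowerSeries.coeff 0 Θ = 1 ∧ (∀ n : ℕ, PowerSeries.coeff n Θ ≠ 0 → ∃ m : ℕ, n = t * m ^ 2) := by
  classical
  refine ⟨PowerSeries.mk fun n : ℕ ↦
      ((Finset.Icc (-(n : ℤ)) n).filter (fun m : ℤ ↦ (t : ℤ) * m ^ 2 = n)).card, ?_, ?_, ?_⟩
  · ext n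
    rw [PowerSeries.coeff_map, PowerSeries.coeff_mk, ← qCoeffs_apply, qCoeffs_thetaMul ht]
    simp
  · rw [PowerSeries.coeff_mk]
    exact card_filter_mul_sq_eq_zero t
  · intro n hn
    rw [PowerSeries.coeff_mk] at hn
    by_contra h
    push Not at h
    exact hn (card_filter_mul_sq_eq_eq_zero h)

/-! ## §7 `q`-expansions of powers and of the product `H · θ(Q²·)^p` -/

/-- `q`-expansions of powers of members of `M_{k/2}(N, χ)`: `qExpansion 1 (fⁿ) = (qExpansion 1 f)ⁿ`
(each power is again a member, so its cusp function is analytic and Mathlib's `qExpansion_mul` applies).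
[folklore] -/
theorem qExpansion_pow_of_mem {k N : ℕ} {χ : DirichletCharacter ℂ N} {f : ℍ → ℂ}
    (hf : f ∈ halfIntModularForms k N χ) (n : ℕ) :
    qExpansion 1 (f ^ n) = qExpansion 1 f ^ n := by
  induction n with
  | zero => simpa using qExpansion_one (1 : ℝ)
  | succ n ih =>
    rw [pow_succ, pow_succ, qExpansion_mul (analyticAt_cuspFunction_of_mem (pow_mem_halfIntModularForms hf n))
      (analyticAt_cuspFunction_of_mem hf), ih]

/-- **`q`-expansion of the product `H · θ(Q²·)^p`** for `H ∈ M_{k₁/2}(N, χ)`: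
`qExpansion 1 (H · θ_{Q²}^p) = qExpansion 1 H · (qExpansion 1 θ_{Q²})^p`, with `qExpansion 1 θ_{Q²}`
given by `qCoeffs_thetaMul` / `exists_powerSeries_nat_qExpansion_thetaMul`. Combined with
`exists_modularForm_mul_thetaMul_sq_pow` (`⇑f = H · θ_{Q²}^p`) this is the `q`-expansion of the
modular form `f`. [folklore] -/
theorem qExpansion_mul_thetaMul_sq_pow {k₁ N : ℕ} {χ : DirichletCharacter ℂ N} {H : ℍ → ℂ}
    (hH : H ∈ halfIntModularForms k₁ N χ) {Q : ℕ} (hQ : 0 < Q) (p : ℕ) :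
    qExpansion 1 (H * thetaMul (Q ^ 2) ^ p) =
      qExpansion 1 H * qExpansion 1 (thetaMul (Q ^ 2)) ^ p := by
  rw [qExpansion_mul (analyticAt_cuspFunction_of_mem hH)
    (analyticAt_cuspFunction_of_mem (thetaMul_sq_pow_mem_halfIntModularForms hQ p)),
    qExpansion_pow_of_mem (thetaMul_sq_mem_halfIntModularForms hQ) p]

/-- **NF-B with its `q`-expansion** (crux notes w8g6 §3.2 / LEAD g13 02:05:23Z «θ₀(Q²z)² ∈ ModularForm
(Gamma1 (4Q²)) 1 with the r₂-type q-expansion»): there is `f ∈ ModularForm (Gamma1 (4Q²)) 1` with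
`⇑f = θ(Q²·)²` and `qExpansion 1 ⇑f = Θ²` where `Θ = Σ_n #{m : Q² m² = n} qⁿ` has natural-number
coefficients, constant term `1` and support in `{Q² m²}` (so `(qExpansion 1 f).coeff n = r₂-type count
`#{(b,b') ∈ ℤ² : Q²(b² + b'²) = n}`). [cite: Tunnell1983Congruent, p. 326] [cite: Shimura1973HalfIntegral, §1] -/
theorem exists_modularForm_thetaMul_sq_sq_qExpansion {Q : ℕ} (hQ : 0 < Q) :
    ∃ (f : ModularForm (Gamma1 (4 * Q ^ 2)) (1 : ℤ)) (Θ : PowerSeries ℕ),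
      ⇑f = thetaMul (Q ^ 2) ^ 2 ∧ qExpansion 1 ⇑f = (Θ ^ 2).map (Nat.castRingHom ℂ) ∧
      PowerSeries.coeff 0 Θ = 1 ∧ (∀ n : ℕ, PowerSeries.coeff n Θ ≠ 0 → ∃ m : ℕ, n = Q ^ 2 * m ^ 2) := by
  obtain ⟨f, hf⟩ := exists_modularForm_thetaMul_sq_pow hQ 1
  obtain ⟨Θ, hΘ, h0, hsupp⟩ := exists_powerSeries_nat_qExpansion_thetaMul (pow_pos hQ 2)
  refine ⟨f, Θ, by simpa using hf, ?_, h0, hsupp⟩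
  rw [hf, mul_one, qExpansion_pow_of_mem (thetaMul_sq_mem_halfIntModularForms hQ) 2, hΘ, map_pow]

/-- **THE NF-A SOCKET WITH ITS `q`-EXPANSION**: for `4Q² ∣ N`, `H ∈ M_{(2k+1)/2}(N, χ)` and `p` odd there
are `f ∈ ModularForm (Gamma1 N) (k + (p+1)/2)` and `Θ ∈ ℕ⟦q⟧` (constant term `1`, support `{Q²m²}`)
with `⇑f = H · θ(Q²·)^p` and `qExpansion 1 ⇑f = qExpansion 1 H · Θ^p`. With `H = H_k` (Cohen) and the
periodic cut of NF-C this is the complex-side datum whose reduction is `G · T` in (CutForm⁶)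
(`T = Θ^p mod p = Σ_b X^{pQ²b²}` by Frobenius). [cite: Shimura1973HalfIntegral, §1] [cite: Cohen1975, Thm. 3.1] -/
theorem exists_modularForm_mul_thetaMul_sq_pow_qExpansion [NeZero N] {Q : ℕ} (hQ : 0 < Q)
    (hN : 4 * Q ^ 2 ∣ N) {k p : ℕ} (hp : Odd p) {χ : DirichletCharacter ℂ N} {H : ℍ → ℂ}
    (hH : H ∈ halfIntModularForms (2 * k + 1) N χ) :
    ∃ (f : ModularForm (Gamma1 N) ((k + (p + 1) / 2 : ℕ) : ℤ)) (Θ : PowerSeries ℕ),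
      ⇑f = H * thetaMul (Q ^ 2) ^ p ∧
      qExpansion 1 ⇑f = qExpansion 1 H * (Θ ^ p).map (Nat.castRingHom ℂ) ∧
      PowerSeries.coeff 0 Θ = 1 ∧ (∀ n : ℕ, PowerSeries.coeff n Θ ≠ 0 → ∃ m : ℕ, n = Q ^ 2 * m ^ 2) := by
  obtain ⟨f, hf⟩ := exists_modularForm_mul_thetaMul_sq_pow hQ hN hp hH
  obtain ⟨Θ, hΘ, h0, hsupp⟩ := exists_powerSeries_nat_qExpansion_thetaMul (pow_pos hQ 2)
  refine ⟨f, Θ, hf, ?_, h0, hsupp⟩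
  rw [hf, qExpansion_mul_thetaMul_sq_pow hH hQ p, hΘ, map_pow]

end Summit.BirchSwinnertonDyer.BirchSwinnertonDyer.Theorems.PrintCFram.HalfIntegralBridge

end
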